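/-
Copyright (c) 2026 the pub-hodgecm-mathlib formalisation cell (harness21).  Prover seat hodgecm-mathlib-K2E1-p15 (g4), Track B ∕ K2-LIT, h413 = `stmt-HodgeConjecture-24833`, route `HCCMUnconditional`,
R90-TF section S8 «ContSpec-n½», (V) road ∕ ESTATE T (S8 dealer R90-CS-plan (g3), S8-R225 (i) ∕ S8-R230 (2) 2026-09-05): the K-finite exports at the witness, ED. 2 — purity and GL-level DISCHARGED.
-/
import Summits.HodgeConjecture.HodgeConjecture.Theorems.R90S8MidWitnessExportsOfTU3            -- ★ p864579 (this seat): ED. 1 `midWitness_exports_of_T_of_coweightLine` (+ §1 left-law read-backs)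
import Summits.HodgeConjecture.HodgeConjecture.Theorems.R90S8PureBlockIsotypicU3               -- ★ p864646 (this seat): `exists_isotypic_of_kMax_irreducible` (the `hVτ` glue, `∃ τ′` shape)
import Summits.HodgeConjecture.HodgeConjecture.Theorems.R90S8ResGMidPureBlockPortBindersU3     -- ★ p864597 (K2E1-p12): `exists_GLlevel_of_isTauLevel` (the `GL₃(𝔸_f)`-level of a τ-level)
import HarnessLib

/-!
# S8 (V) ∕ ESTATE T — `R90S8MidWitnessExportsOfTV2U3` (ED. 2 of ★ p864579): THE K-FINITE `χ`-EISENSTEIN EXPORTS AT THE `K_max`-BLOCK OF A τ-ADMISSIBLE WITNESS WITH THE PURITY LETTER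
# `hVτ` AND THE `GL₃`-LEVEL BINDERS DISCHARGED — visible: the IRREDUCIBILITY of the witness's block and THE CO-WEIGHT LINE `hCO` in the shape of record (★ `R90S8ResGMidRowsOfTauExportsClosedU3`)

Track B ∕ K2-LIT, crux h413 = `stmt-HodgeConjecture-24833`, route of record `HCCMUnconditional`; cell `hodgecm-mathlib`, R90-TF programme, section S8 «ContSpec-n½», (V) :358 witness road ∕
ESTATE T (rulings J-S8-T2, J-S8-T2′, J-S8-WIT′).  THEOREMS ONLY (no `def`, no `instance`, no `notation`, no named-fact hypothesis, no `sorry`; default heartbeats); lane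
`--supports stmt-HodgeConjecture-24833 --as helper` (count-neutral).  CLOSES NO SOCKET.  Pure COMPOSITION over ★ ED. 1.

WHAT CHANGES FROM ED. 1 ([MoeglinWaldspurger1995, I.2.17, IV.1.8–IV.1.11]; [BernsteinLapid2019, Thm 2.3, §4 Claim 1]; [BrockerTomDieck1985, II (4.14)]; [Knapp1986, VII §1–§2]).  ★ ED. 1
`midWitness_exports_of_T_of_coweightLine` delivers the full K-finite export package at the `K_max`-block `V := span r(K_max)φ` of a τ-admissible continuous bounded arch-finite witness `φ`
modulo (a) a `GL₃(𝔸_f)`-level `U₀′` reading the τ-level `U₀`, (b) the purity letter `hVτ` («`V` is `W`-isotypic») for a bare `K_∞`-type `(W, τ)`, (c) the co-weight line `hco` for that `τ`.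
Here (a) is ★ `exists_GLlevel_of_isTauLevel` (K2E1-p12), (b) is ★ `exists_isotypic_of_kMax_irreducible` (the `hVτ` glue: a `K_max`-IRREDUCIBLE block is `W₀`-isotypic for a minimal
`K_∞`-stable `W₀ ≤ V`, with a bare `τ′ = r|_{W₀}` on `ι⁻¹ι(K_∞)`), so the head's visible pure-type data shrink to: the IRREDUCIBILITY of the witness's block under `r(K_max)` (`hVirr` — for the
shifted witness of record this is K2E1-p13's (β) row in its natural strong form) and THE CO-WEIGHT LINE `hCO` quantified over ALL irreducible finite-dimensional `K_∞`-types `W₀` realised in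
functions, in the LETTER SHAPE OF RECORD of ★ `R90S8ResGMidRowsOfTauExportsClosedU3` (K2E1-p12 FILE B; its payer `hCO_of_transposeRealisations` — ★ (α) p864279 per complex place × the product
over `w ∣ ∞` — is K2E1-p12's S8-R229 (1); when it lands the consumer binds it BY NAME and the exports at the witness are letter-free over the frame + `hVirr`).
* **`midWitness_exports_of_T_v2 (hχ₂) (hU₀) (hN) (hφ hφc hφM hφa) (hVirr) (hCO)`** ⊢ ★ T head's ∃-package AT `φ`, byte for byte.
HONEST LABEL: HC_CM is proved only modulo the 7 printed citations (2 remaining named inputs: hLiu418 = `stmt-HodgeConjecture-24832`, h413 = `stmt-HodgeConjecture-24833`) until rung 0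
closes; REL ≠ ★ ≠ BUILT; composition — `hVirr` and `hCO` stay VISIBLE; pays no socket ((V) :358 stays `sorry` in B); count-neutral.

## References
* [MoeglinWaldspurger1995] C. Mœglin, J.-L. Waldspurger, *Spectral Decomposition and Eisenstein Series* (1995), I.2.17, II.1.7, IV.1.8–IV.1.11.
* [BernsteinLapid2019] J. Bernstein, E. Lapid, *On the meromorphic continuation of Eisenstein series*, J. Amer. Math. Soc. 37 (2024), Thm 2.3, §4 Claim 1.
* [BrockerTomDieck1985] T. Bröcker, T. tom Dieck, *Representations of Compact Lie Groups*, GTM 98 (1985), II (4.14).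
* [Knapp1986] A. W. Knapp, *Representation Theory of Semisimple Groups* (1986), VII §1–§2.
-/

set_option autoImplicit false
set_option linter.dupNamespace false  -- the mandated namespace `…HodgeConjecture.HodgeConjecture.R90.S8` (LEAD #1 L1) repeats the summit's segment

noncomputable section

open MeasureTheory Measure Filter Topology Set NumberField IsDedekindDomain ContRepresentation
open scoped NNReal ENNReal
open Literature.MeasureTheory.Group Literature.NumberTheory Literature.NumberTheory.Automorphic Literature.NumberTheory.Automorphic.UnitaryGroup Literature.NumberTheory.GaloisRepresentations AdelicGroupData
open Literature.NumberTheory.Automorphic.Arthur2013.Leaves.TECR Literature.NumberTheory.Rogawski1990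
open Summit.HodgeConjecture.HodgeConjecture.Cruxes.H413.K2E1BorelEisensteinU
open Summit.HodgeConjecture.HodgeConjecture.Cruxes.H413.K2E1BLBorelSpacesU2Defs
open Summit.HodgeConjecture.HodgeConjecture.Cruxes.H413.K2E1BLBorelOperatorsU2Defs
open Summit.HodgeConjecture.HodgeConjecture.Cruxes.H413.K2E1CharacterEisensteinU2Defs
open Summit.HodgeConjecture.HodgeConjecture.Cruxes.H413.K2E1BLIotaClosedEmbeddingU3 (iotaBound_cm_three)
open Summit.HodgeConjecture.HodgeConjecture.Cruxes.H413.K2E1CharacterEisensteinU3PairDefs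
open Summit.HodgeConjecture.HodgeConjecture.Cruxes.H413.K2E1ChiSectionSpaceU3PairDefs

namespace Summit.HodgeConjecture.HodgeConjecture.R90.S8

variable (L : Type) [Field L] [NumberField L] [IsCMField L]
  [MeasurableSpace (quasiSplit (↥(maximalRealSubfield L)) L (IsCMField.complexConj L) 3).Adelic] [BorelSpace (quasiSplit (↥(maximalRealSubfield L)) L (IsCMField.complexConj L) 3).Adelic]
  [MeasurableSpace (arch (↥(maximalRealSubfield L)) L (IsCMField.complexConj L) 3 ((StdForm.antidiagonal 3).over L))] [BorelSpace (arch (↥(maximalRealSubfield L)) L (IsCMField.complexConj L) 3 ((StdForm.antidiagonal 3).over L))]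
  [MeasurableSpace (finAdelic (↥(maximalRealSubfield L)) L (IsCMField.complexConj L) 3 ((StdForm.antidiagonal 3).over L))] [BorelSpace (finAdelic (↥(maximalRealSubfield L)) L (IsCMField.complexConj L) 3 ((StdForm.antidiagonal 3).over L))]

/-- **ED. 2 HEAD — THE K-FINITE EXPORTS AT THE `K_max`-BLOCK OF A τ-ADMISSIBLE WITNESS, PURITY AND LEVEL DISCHARGED**: for `χ₂` automorphic, a normal τ-level `U₀`, and a τ-admissible
continuous bounded arch-finite witness `φ` whose `K_max`-block `V := span r(K_max)φ` is IRREDUCIBLE under `r(K_max)` (`hVirr`), given THE CO-WEIGHT LINE `hCO` in the letter shape of record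
(for every irreducible finite-dimensional `K_∞`-type `W₀` realised in functions, the `χ₁(m₀₀)χ₂(m₁₁)`-co-weight functionals of `W₀` form a line): the conclusion of ★
`chiEisenstein_meromorphic_exports_kfinite_of_ports` AT `φ` — ★ ED. 1 `midWitness_exports_of_T_of_coweightLine` with `U₀′` := ★ `exists_GLlevel_of_isTauLevel`, `(W, τ, hVτ)` := ★
`exists_isotypic_of_kMax_irreducible` at `V`, and its `hco` read off `hCO W₀` through `τ′ = r|_{W₀}` on `ι⁻¹ι(K_∞)`.
[cite: MoeglinWaldspurger1995, I.2.17, IV.1.8–IV.1.11] [cite: BernsteinLapid2019, Thm 2.3, §4 Claim 1] [cite: BrockerTomDieck1985, II (4.14)] [cite: Knapp1986, VII §1–§2] -/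
theorem midWitness_exports_of_T_v2
    (μ : Measure (quasiSplit (↥(maximalRealSubfield L)) L (IsCMField.complexConj L) 3).automorphicQuotient) [(quasiSplit (↥(maximalRealSubfield L)) L (IsCMField.complexConj L) 3).IsAutomorphicMeasure μ]
    (νG : Measure (quasiSplit (↥(maximalRealSubfield L)) L (IsCMField.complexConj L) 3).Adelic) [νG.IsHaarMeasure] [νG.IsInvInvariant] [SFinite νG]
    (ν : Measure ↥(adelicUnipotent (↥(maximalRealSubfield L)) L (IsCMField.complexConj L) 3)) [ν.IsHaarMeasure] [ν.IsMulRightInvariant] [ν.IsInvInvariant]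
    {𝓕 : Set ↥(adelicUnipotent (↥(maximalRealSubfield L)) L (IsCMField.complexConj L) 3)}
    (h𝓕N : IsFundamentalDomain ↥(rationalUnipotent (↥(maximalRealSubfield L)) L (IsCMField.complexConj L) 3) 𝓕 ν) (h𝓕c : IsCompact (closure 𝓕)) (h𝓕₀ : ν 𝓕 ≠ 0)
    {β : (quasiSplit (↥(maximalRealSubfield L)) L (IsCMField.complexConj L) 3).Adelic → ℝ≥0∞}
    (hβ : IsCoveringWeight ↥((arithmeticBorel (↥(maximalRealSubfield L)) L (IsCMField.complexConj L) 3).map (quasiSplit (↥(maximalRealSubfield L)) L (IsCMField.complexConj L) 3).arithmeticSubgroup.subtype) β)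
    {μZ : Measure (borelQuotient (↥(maximalRealSubfield L)) L (IsCMField.complexConj L) 3)} [SFinite μZ]
    (hμZ : ∀ f : borelQuotient (↥(maximalRealSubfield L)) L (IsCMField.complexConj L) 3 → ℝ≥0∞, Measurable f → ∫⁻ z, f z ∂μZ = ∫⁻ g, β g * f (toBorelQuotient (↥(maximalRealSubfield L)) L (IsCMField.complexConj L) 3 g) ∂νG)
    (μa : Measure (arch (↥(maximalRealSubfield L)) L (IsCMField.complexConj L) 3 ((StdForm.antidiagonal 3).over L))) [μa.IsHaarMeasure] [μa.IsMulRightInvariant]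
    (μf : Measure (finAdelic (↥(maximalRealSubfield L)) L (IsCMField.complexConj L) 3 ((StdForm.antidiagonal 3).over L))) [μf.IsHaarMeasure]
    -- the block characters (`χ₂` automorphic) and the τ-LEVEL `U₀` (τ-admissible, normal in `G(𝒪̂)_f`)
    {χ₁ : HeckeCharacter L} {χ₂ : ↥(TorusDict.torus (IsCMField.complexConj L)) →ₜ* ℂˣ} (hχ₂ : TorusDict.IsAutomorphic (IsCMField.complexConj L) χ₂)
    {U₀ : Subgroup ↥(finAdelic (↥(maximalRealSubfield L)) L (IsCMField.complexConj L) 3 ((StdForm.antidiagonal 3).over L))} (hU₀ : IsTauLevel L U₀)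
    (hN : ∀ b ∈ (finAdelicIntegralLevel (↥(maximalRealSubfield L)) L (IsCMField.complexConj L) 3 ((StdForm.antidiagonal 3).over L)), ∀ u ∈ U₀, b * u * b⁻¹ ∈ U₀)
    -- THE WITNESS AS BINDERS (J-S8-WIT′)
    {φ : (quasiSplit (↥(maximalRealSubfield L)) L (IsCMField.complexConj L) 3).Adelic → ℂ}
    (hφ : φ ∈ chiSectionSpacePair χ₁ χ₂ (tauLevel L U₀) ((1 : ↥(tauLevel L U₀) →* ℂ) : ↥(tauLevel L U₀) → ℂ)) (hφc : Continuous φ) (hφM : ∃ M : ℝ, ∀ x, ‖φ x‖ ≤ M) (hφa : IsArchFinite L φ)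
    -- VISIBLE (1): the witness's `K_max`-block is IRREDUCIBLE under `r(K_max)` (purity in its strong form; K2E1-p13's (β) row for the shifted witness)
    (hVirr : ∃ hV : ∀ k : ↥((standardMaximalCompactGL 3 L).comap (adelicVal (↥(maximalRealSubfield L)) L (IsCMField.complexConj L) 3 ((StdForm.antidiagonal 3).over L)) : Subgroup (quasiSplit (↥(maximalRealSubfield L)) L (IsCMField.complexConj L) 3).Adelic),
        ∀ ψ ∈ Submodule.span ℂ (Set.range fun k : ↥((standardMaximalCompactGL 3 L).comap (adelicVal (↥(maximalRealSubfield L)) L (IsCMField.complexConj L) 3 ((StdForm.antidiagonal 3).over L)) : Subgroup (quasiSplit (↥(maximalRealSubfield L)) L (IsCMField.complexConj L) 3).Adelic) =>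
          ((rightTranslation (quasiSplit (↥(maximalRealSubfield L)) L (IsCMField.complexConj L) 3)).comp ((standardMaximalCompactGL 3 L).comap (adelicVal (↥(maximalRealSubfield L)) L (IsCMField.complexConj L) 3 ((StdForm.antidiagonal 3).over L)) : Subgroup (quasiSplit (↥(maximalRealSubfield L)) L (IsCMField.complexConj L) 3).Adelic).subtype) k φ),
        ((rightTranslation (quasiSplit (↥(maximalRealSubfield L)) L (IsCMField.complexConj L) 3)).comp ((standardMaximalCompactGL 3 L).comap (adelicVal (↥(maximalRealSubfield L)) L (IsCMField.complexConj L) 3 ((StdForm.antidiagonal 3).over L)) : Subgroup (quasiSplit (↥(maximalRealSubfield L)) L (IsCMField.complexConj L) 3).Adelic).subtype) k ψ ∈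
          Submodule.span ℂ (Set.range fun k : ↥((standardMaximalCompactGL 3 L).comap (adelicVal (↥(maximalRealSubfield L)) L (IsCMField.complexConj L) 3 ((StdForm.antidiagonal 3).over L)) : Subgroup (quasiSplit (↥(maximalRealSubfield L)) L (IsCMField.complexConj L) 3).Adelic) =>
            ((rightTranslation (quasiSplit (↥(maximalRealSubfield L)) L (IsCMField.complexConj L) 3)).comp ((standardMaximalCompactGL 3 L).comap (adelicVal (↥(maximalRealSubfield L)) L (IsCMField.complexConj L) 3 ((StdForm.antidiagonal 3).over L)) : Subgroup (quasiSplit (↥(maximalRealSubfield L)) L (IsCMField.complexConj L) 3).Adelic).subtype) k φ),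
      (Subrepresentation.toRepresentation (⟨Submodule.span ℂ (Set.range fun k : ↥((standardMaximalCompactGL 3 L).comap (adelicVal (↥(maximalRealSubfield L)) L (IsCMField.complexConj L) 3 ((StdForm.antidiagonal 3).over L)) : Subgroup (quasiSplit (↥(maximalRealSubfield L)) L (IsCMField.complexConj L) 3).Adelic) =>
          ((rightTranslation (quasiSplit (↥(maximalRealSubfield L)) L (IsCMField.complexConj L) 3)).comp ((standardMaximalCompactGL 3 L).comap (adelicVal (↥(maximalRealSubfield L)) L (IsCMField.complexConj L) 3 ((StdForm.antidiagonal 3).over L)) : Subgroup (quasiSplit (↥(maximalRealSubfield L)) L (IsCMField.complexConj L) 3).Adelic).subtype) k φ), hV⟩ :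
        Subrepresentation ((rightTranslation (quasiSplit (↥(maximalRealSubfield L)) L (IsCMField.complexConj L) 3)).comp ((standardMaximalCompactGL 3 L).comap (adelicVal (↥(maximalRealSubfield L)) L (IsCMField.complexConj L) 3 ((StdForm.antidiagonal 3).over L)) : Subgroup (quasiSplit (↥(maximalRealSubfield L)) L (IsCMField.complexConj L) 3).Adelic).subtype))).IsIrreducible)
    -- VISIBLE (2): THE CO-WEIGHT LINE, letter shape of record (★ `R90S8ResGMidRowsOfTauExportsClosedU3`), at the pair `(χ₁, χ₂)`
    (hCO : ∀ (W₀ : Submodule ℂ ((quasiSplit (↥(maximalRealSubfield L)) L (IsCMField.complexConj L) 3).Adelic → ℂ)) (hW₀K : ∀ k : ↥(archMaximalCompact L), ∀ ψ ∈ W₀, ((rightTranslation (quasiSplit (↥(maximalRealSubfield L)) L (IsCMField.complexConj L) 3)).comp (archMaximalCompact L).subtype) k ψ ∈ W₀) (_ : FiniteDimensional ℂ ↥W₀) (_ : (Subrepresentation.toRepresentation (⟨W₀, hW₀K⟩ : Subrepresentation ((rightTranslation (quasiSplit (↥(maximalRealSubfield L)) L (IsCMField.complexConj L) 3)).comp (archMaximalCompact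 L).subtype))).IsIrreducible),
      ∃ l₀ : ↥W₀ →ₗ[ℂ] ℂ, ∀ l : ↥W₀ →ₗ[ℂ] ℂ,
        (∀ (m : ↥(arch (↥(maximalRealSubfield L)) L (IsCMField.complexConj L) 3 ((StdForm.antidiagonal 3).over L))) (hmB : (archToAdelic (↥(maximalRealSubfield L)) L (IsCMField.complexConj L) 3 ((StdForm.antidiagonal 3).over L)) m ∈ borelAdelic (↥(maximalRealSubfield L)) L (IsCMField.complexConj L) 3) (hmK : (adelicVal (↥(maximalRealSubfield L)) L (IsCMField.complexConj L) 3 ((StdForm.antidiagonal 3).over L)) ((archToAdelic (↥(maximalRealSubfield L)) L (IsCMField.complexConj L) 3 ((StdForm.antidiagonal 3).over L)) m) ∈ standardMaximalCompactGL 3 L) (w : ↥W₀),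
          l ((Subrepresentation.toRepresentation (⟨W₀, hW₀K⟩ : Subrepresentation ((rightTranslation (quasiSplit (↥(maximalRealSubfield L)) L (IsCMField.complexConj L) 3)).comp (archMaximalCompact L).subtype))) ⟨(archToAdelic (↥(maximalRealSubfield L)) L (IsCMField.complexConj L) 3 ((StdForm.antidiagonal 3).over L)) m, archToAdelic_mem_archMaximalCompact L m hmK⟩ w) = ((χ₁ (firstEntryUnit hmB) : ℂˣ) : ℂ) * ((χ₂ (middleEntryUnitary hmB) : ℂˣ) : ℂ) * l w) →
        ∃ a : ℂ, l = a • l₀)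
    : ∃ (n : ℕ) (φ' : Fin n → (quasiSplit (↥(maximalRealSubfield L)) L (IsCMField.complexConj L) 3).Adelic → ℂ) (q : Fin n → ℂ → ℂ) (Ec : ℂ → (quasiSplit (↥(maximalRealSubfield L)) L (IsCMField.complexConj L) 3).Adelic → ℂ) (qc : Fin n → ℂ → ℂ) (P : Set ℂ),
      LinearIndependent ℂ φ' ∧ (∀ j, IsChiSectionPair (reflectChar (IsCMField.complexConj L) χ₁) χ₂ (φ' j)) ∧ (∀ j, Continuous (φ' j)) ∧ (∃ Mb : ℝ, ∀ j x, ‖φ' j x‖ ≤ Mb) ∧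
      (∀ j, DifferentiableOn ℂ (q j) {z : ℂ | 2 < z.re}) ∧
      (∀ z : ℂ, 2 < z.re → (∑ j, q j z • φ' j) = ((((ν 𝓕).toReal⁻¹ : ℝ)) : ℂ) • (fun g : (quasiSplit (↥(maximalRealSubfield L)) L (IsCMField.complexConj L) 3).Adelic => (∫ v : ↥(adelicUnipotent (↥(maximalRealSubfield L)) L (IsCMField.complexConj L) 3), flatSectionU φ z ((quasiSplit (↥(maximalRealSubfield L)) L (IsCMField.complexConj L) 3).toAdelic (weylLongU ((IsCMField.complexConj L : L ≃ₐ[↥(maximalRealSubfield L)] L) : L →+* L) (rfl : (StdForm.antidiagonal 3).over L = (StdForm.antidiagonal 3).over L)) * ((v : (quasiSplit (↥(maximalRealSubfield L)) L (IsCMField.complexConj L) 3).Adelic) * g)) ∂ν) * (((borelHeight g : ℝ) : ℂ) ^ (z - 2)))) ∧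
      ((∀ g, MeromorphicNFOn (fun z => Ec z g) univ) ∧ (∀ j, MeromorphicNFOn (qc j) univ) ∧
      (∀ z : ℂ, 2 < z.re → Ec z = eisensteinSeriesU (flatSectionU φ z)) ∧ (∀ j (z : ℂ), 2 < z.re → qc j z = q j z) ∧
      IsClosed P ∧ (∀ z₀ : ℂ, ∀ᶠ s in 𝓝[≠] z₀, s ∉ P) ∧ (∀ z ∈ P, z.re ≤ 2) ∧
      (∀ g (z : ℂ), z ∉ P → AnalyticAt ℂ (fun z => Ec z g) z) ∧ (∀ j (z : ℂ), z ∉ P → AnalyticAt ℂ (qc j) z) ∧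
      (∀ g, DifferentiableOn ℂ (fun z => Ec z g) Pᶜ) ∧ (∀ j, DifferentiableOn ℂ (qc j) Pᶜ) ∧
      (∀ z : ℂ, z ∉ P → Continuous (Ec z)) ∧
      (∀ z₁ : ℂ, z₁ ∉ P → ∀ K : Set (quasiSplit (↥(maximalRealSubfield L)) L (IsCMField.complexConj L) 3).Adelic, IsCompact K → ∃ V ∈ 𝓝 z₁, ∃ M : ℝ, ∀ z ∈ V, ∀ g ∈ K, ‖Ec z g‖ ≤ M)) := by
  -- (a) the `GL₃(𝔸_f)`-level of the τ-level (★ K2E1-p12)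
  obtain ⟨U₀', hU₀'o, hU₀'c, hU₀'K, hKfU₀⟩ := exists_GLlevel_of_isTauLevel L hU₀
  -- (b) the `hVτ` glue at the witness's `K_max`-block
  have hSV := span_kMaxTranslates_le_chiSectionSpacePair_tauLevel L hN hφ
  haveI := finiteDimensional_span_comp_subtype_kMax_of_mem_chiSectionSpacePair_tauLevel L hU₀ hφ hφa
  obtain ⟨hV, hirr⟩ := hVirr
  obtain ⟨W₀, hW₀K, -, hW₀fd, hirr₀, -, τ', hτ', hVτ⟩ := exists_isotypic_of_kMax_irreducible L (commute_tauLevel_archMaximalCompact L U₀) _ hV hirr hSV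
  -- (c) the co-weight line for `τ′` read off the letter of record at `W₀`
  obtain ⟨l₀, hl₀⟩ := hCO W₀ hW₀K hW₀fd hirr₀
  refine midWitness_exports_of_T_of_coweightLine L μ νG ν h𝓕N h𝓕c h𝓕₀ hβ hμZ μa μf hχ₂ hU₀ hN U₀' hU₀'o hU₀'c hU₀'K hKfU₀ hφ hφc hφM hφa τ' hVτ ⟨l₀, fun l hl => hl₀ l fun m hmB hmK w => ?_⟩
  have hmK' : m ∈ (((standardMaximalCompactGL 3 L).comap (adelicVal (↥(maximalRealSubfield L)) L (IsCMField.complexConj L) 3 ((StdForm.antidiagonal 3).over L))).comap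
      (archToAdelic (↥(maximalRealSubfield L)) L (IsCMField.complexConj L) 3 ((StdForm.antidiagonal 3).over L))) := Subgroup.mem_comap.2 (Subgroup.mem_comap.2 hmK)
  have h := hl m (Subgroup.mem_comap.2 hmB) hmK' w
  rw [hτ' m (archToAdelic_mem_archMaximalCompact L m hmK)] at h
  simpa only [dif_pos hmB] using h

end Summit.HodgeConjecture.HodgeConjecture.R90.S8

end
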